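import Summits.CriticalPhenomena.Ising3DConformalLimit.Theorems.ArmHyperscalingOneArmHyperscalingMirrorFaceDefs
import Summits.CriticalPhenomena.Ising3DConformalLimit.Theorems.ArmHyperscalingOneArmHyperscalingStubMirrorCauchySchwarz
import Summits.CriticalPhenomena.Ising3DConformalLimit.Theorems.ArmHyperscalingOneArmHyperscalingStubPlusMagSubmodular
import Summits.CriticalPhenomena.Ising3DConformalLimit.Theorems.ArmHyperscalingOneArmHyperscalingStubBoxMagMarkov
import Summits.CriticalPhenomena.Ising3DConformalLimit.Theorems.ArmHyperscalingOneArmHyperscalingStubFaceGeometry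
import Summits.CriticalPhenomena.Ising3DConformalLimit.Theorems.ArmHyperscalingOneArmHyperscalingStubFaceSymmetry
import Summits.CriticalPhenomena.Ising3DConformalLimit.Theorems.ArmHyperscalingOneArmHyperscalingStubFaceLimit
import Summits.CriticalPhenomena.Ising3DConformalLimit.Theorems.ArmHyperscalingOneArmHyperscalingCasimirReduction
import Summits.CriticalPhenomena.Ising3DConformalLimit.Theorems.ArmHyperscalingOneArmHyperscalingFaceCoreIff
import Literature.Probability.LatticeModels.HighDimPointwiseTriviality
import HarnessLib

/-!
# Crux `ArmHyperscaling.OneArmHyperscaling` (stmt-CriticalPhenomena-15591) — skeleton, line `mirror-face-saturation`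

Strategist line (planner-cstrat-stmt-CriticalPhenomena-15591-b1-0, 2026-08-17); RESHAPED by the lead
(prover-line-stmt-CriticalPhenomena-15591-0, 2026-08-17): the face-subadditivity statement `FaceSubadditivity` is
now DERIVED (`faceSubadditivity_of`, sorry-free) from five worker-sized stubs — `stub_plusMagSubmodular` (discrete
GHS: the plus magnetisation is submodular in the frozen set), `stub_boxMagMarkov` (translation + domain Markov: the
plus box is the big box with its six exterior faces frozen), `stub_faceGeometry` (the six faces are disjoint, avoid
the centre, sit in the big box), `stub_faceSymmetry` (lattice isometries carry each face to the `−e₀` face) and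
`stub_faceLimit` (the face-frozen magnetisation converges to `faceMag` along translated boxes); the statements
`MirrorCauchySchwarz`, `FaceSubadditivity`, `FaceSaturation` and the composition `OneArmHyperscaling_of` are unchanged.

STATUS (lead, 2026-08-17 ~13:00Z): the vocabulary and all eight statements live in the LANDED definitions module
`Theorems/ArmHyperscalingOneArmHyperscalingMirrorFaceDefs.lean` (p158919, with the registered glue sub-goal
`plusBoxMag_nonneg`); SIX of the seven stubs are LANDED and imported here —
`stub_mirrorCauchySchwarz` (p160282), `stub_plusMagSubmodular` (p160632), `stub_boxMagMarkov` (p161308),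
`stub_faceGeometry` (p161080), `stub_faceSymmetry` (p161255), `stub_faceLimit` (p161287).  The only `sorry` left is
the OPEN CORE `stub_faceSaturation`; `OneArmHyperscaling_of_faceSaturation : FaceSaturation → OneArmHyperscaling`
below is sorry-free (the crux is formally reduced to the face-saturation inequality).

## The line in one paragraph

The crux `(m⁺_{Kn})² ≤ C ⟨σ₀σ_{2ne₀}⟩_{β_c}` compares a ONE-POINT function under a plus boundary at
scale `Kn` with the TWO-POINT function at the shorter scale `2n`.  Osterwalder–Schrader / reflection
positivity of the critical state in the site mirror `𝕏 = {y₀ = 0}` (Fröhlich–Israel–Lieb–Simon 1978)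
does the transfer between the two scales for free: for the spin `σ_x`, `x = n e₀`, and the patch
magnetisation `M_A = ∑_{y ∈ A} σ_y` of a planar patch `A ⊂ {y₀ = Kn + 1 − n}` on the same side of `𝕏`,
the Cauchy–Schwarz inequality of the OS inner product reads

  `T² = ⟨σ_x M_{θA}⟩² ≤ ⟨σ_x σ_{θx}⟩ · ⟨M_A M_{θA}⟩ = ⟨σ₀σ_{2ne₀}⟩ · S`        (stub `stub_mirrorCauchySchwarz`)

where `θA` is the mirror image of `A` — chosen to be EXACTLY the exterior `−e₀` face of the plus box
`Λ_{Kn} + x`.  The plus box is the conditioning of the critical state on its six exterior faces being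
plus (DLR), and the GHS inequality (decreasing increments of the magnetisation in non-negative
boundary fields) makes the centre magnetisation SUBADDITIVE over the faces, so that by lattice symmetry

  `0 ≤ m⁺_{Kn} ≤ 6 F`,  `F := ⟨σ_x | θA all plus⟩_{β_c}`                           (stub `stub_faceSubadditivity`).

What is left is a ONE-SCALE statement about one planar patch in the infinite critical state, the
**face-saturation inequality**

  `F ≤ C · T / √S`                                                                 (stub `stub_faceSaturation`, OPEN CORE):

the magnetisation radiated to distance `Kn` by a fully plus patch of half-width `Kn` is at most a
constant times the Cauchy–Schwarz-normalised LINEAR response `T/√S` of `σ_x` to a field on that patch.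
Scaling theory: `F ≍ ℓ^{-Δσ}`, `T ≍ ℓ² ℓ^{-2Δσ}`, `S ≍ ℓ⁴ ℓ^{-2Δσ}` (`ℓ = Kn`), so both sides are
`≍ ℓ^{-Δσ}` in `d = 3` (and in `d = 2`); in `d ≥ 5` the left side is `≍ ℓ^{-1}` (mean-field profile,
Handa–Heydenreich–Sakai) while `T/√S ≍ ℓ^{1-d/2}`, so the inequality FAILS exactly when hyperscaling
does (`d > 4`): the dimension-specific input of the crux is isolated in this single stub, the other two
stubs hold in every dimension.  Composition: `m⁺² ≤ 36 F² ≤ 36 C² T²/S ≤ 36 C² ⟨σ₀σ_{2ne₀}⟩`.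

## Vocabulary (all over existing Literature declarations)

* `evalSite n = n e₀`; `facePatch K n = {y₀ = n − Kn − 1, |y₁|,|y₂| ≤ Kn}` (the exterior `−e₀` face of
  `box 3 (K n) + n e₀`); `mirrorPatch K n` its image under `y₀ ↦ −y₀`;
* `critExpect F = plusExpect 3 (criticalBeta 3) 0 F` (the critical state; at `β_c(3)` it is the unique
  Gibbs measure, `hasUniqueGibbsMeasure_criticalBeta_holds`);
* `faceMag K n = ⟨σ_x · 𝟙{θA plus}⟩ / ⟨𝟙{θA plus}⟩` with `𝟙{B plus} = plusIndicator B` (`IsingMonotonicity`);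
* `faceResponse K n = ∑_{y ∈ θA} ⟨σ_x σ_y⟩_{β_c}`, `mirrorGram K n = ∑_{y ∈ A, y' ∈ θA} ⟨σ_y σ_{y'}⟩_{β_c}`
  (`criticalCorr 3 2`);
* `plusBoxMag K n` = the crux's left-hand side `⟨σ₀⟩⁺_{Λ_{Kn};β_c,0}` verbatim.
-/

noncomputable section

namespace Summit.CriticalPhenomena.Ising3DConformalLimit.Cruxes.OneArmHyperscaling.MirrorFaceSaturation

open Literature.Probability.LatticeModels Finset

/-! ### The open core, in two alternative forms (EITHER closes the crux)

STATUS 2026-08-17 ~13:45Z: everything else is landed — `OneArmHyperscaling_of_faceSaturation` (p161618),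
`OneArmHyperscaling_of_casimir` (p163130), `oneArmHyperscaling_iff_face` (p163396, the crux ↔ `faceMag² ≤ C·G(2n)`).
The two stubs below are ALTERNATIVES (not both needed): `FaceSaturation` (SAT: F ≤ C·T/√S) and `CasimirBound`
(CAS: P(A⁺∩θA⁺) ≤ C·P(A⁺)P(θA⁺)); each is a strict strengthening of the crux, each fails for d > 4 like the crux,
and any proof of either yields a polynomial upper bound on the one-arm m⁺_L (open: arXiv:2510.23423, after Thm 1.12).
Numerical tests pending: jobs j026127/j025704 (R = F√S/T, Qcs, ρ) and j026340 (Δ = log Casimir overlap). -/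

/-- Stub 3 · the face-saturation inequality (OPEN CORE, form SAT; the d = 3 hyperscaling content of the crux). -/
theorem stub_faceSaturation : FaceSaturation := by
  sorry

/-- Stub 3′ · the bounded Casimir overlap (OPEN CORE, alternative form CAS; closes the crux WITHOUT `stub_faceSaturation`
through the landed `OneArmHyperscaling_of_casimir`). -/
theorem stub_casimirBound : CasimirBound := by
  sorry

/-! ### Glue — all LANDED and imported: `faceSubadditivity_of`, `faceSubadditivity_proof`, `OneArmHyperscaling_of`,
`OneArmHyperscaling_of_faceSaturation` (Theorems/ArmHyperscalingOneArmHyperscalingReduction.lean),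
`OneArmHyperscaling_of_casimir` (…CasimirReduction.lean), `faceMag_le_plusBoxMag`, `oneArmHyperscaling_iff_face` (…FaceCoreIff.lean). -/

/-- The line closes the crux once `stub_faceSaturation` is a theorem (today this term depends on `sorryAx`
through that single stub; it records the intended final assembly). -/
theorem OneArmHyperscaling_proof :
    Summit.CriticalPhenomena.Ising3DConformalLimit.Theses.ArmHyperscaling.OneArmHyperscaling :=
  OneArmHyperscaling_of_faceSaturation stub_faceSaturation

/-- Alternative final assembly through the Casimir core alone (depends on `sorryAx` only through `stub_casimirBound`). -/
theorem OneArmHyperscaling_proof' :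
    Summit.CriticalPhenomena.Ising3DConformalLimit.Theses.ArmHyperscaling.OneArmHyperscaling :=
  OneArmHyperscaling_of_casimir stub_casimirBound

end Summit.CriticalPhenomena.Ising3DConformalLimit.Cruxes.OneArmHyperscaling.MirrorFaceSaturation

end
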